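import Summits.KontsevichZagierPeriods.KontsevichZagierPeriods.Theses.TorsionLogs

/-!
# F3 WITNESS for the rung `NeronTorsionGenusTwo` (line `NeronTorsionGenusTwo` on crux `TorsionSectorComplete`,
# stmt-KontsevichZagierPeriods-14212; forward generator G1 `next-rung`, gen 14, seed = stmt-KontsevichZagierPeriods-17981)

The rung is the genus-graded family `NeronTorsionGenusTwoMember : Bool → Prop` — member `false` := the floor decl
`Theses.TorsionLogs.NeronTorsionPrimitiveChain` VERBATIM (genus one: the seed, CLOSED), member `true` := the tied genus-two
Néron sector statement `GenusTwoNeronSector` (Néron function of `Θ ⊂ Jac` at a real torsion PAIR of a real quintic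
`M`-curve) — and `NeronTorsionGenusTwo := ∀ b, NeronTorsionGenusTwoMember b`.  The floor specialises the rung at the
parameter `b := false`: the seed theorem (route link `Theses.TorsionLogs.NeronTorsionPrimitiveChain_holds :=
Cruxes.NeronTorsionSector.Translation.stub_assembly`, item stmt-KontsevichZagierPeriods-17981) IS that member (`Iff.rfl`),
and conversely the rung gives back the floor both BY NAME (`floor_of_rung`) and as the floor theorem's verbatim TYPE
(`floorStatement_of_rung`, the shape of the tribunal's `Rung → ⟨type of stub_assembly⟩` probe).
No `sorry`.  Self-contained: verbatim copies of the `def`s of `Lines/NeronTorsionGenusTwo.lean` in the namespace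
`…NeronTorsionGenusTwo.Special` (the skeleton module proves the same facts about the registered decls).
[cite: KontsevichZagier2001, §1.2] [cite: Lang1983, Ch. 11 Thm 1.1, Ch. 13]
-/

noncomputable section

-- `Summit.KontsevichZagierPeriods.KontsevichZagierPeriods.…` is the tree's mandated layout (single-conjunct summit).
set_option linter.dupNamespace false

namespace Summit.KontsevichZagierPeriods.KontsevichZagierPeriods.Cruxes.TorsionSectorComplete.NeronTorsionGenusTwo.Special

open Literature.NumberTheory.Transcendental
open Summit.KontsevichZagierPeriods.KontsevichZagierPeriods.Theses.TorsionLogs (NeronTorsionPrimitiveChain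
  NeronTorsionPrimitiveChain_holds)

/-- Verbatim copy of `Lines/NeronTorsionGenusTwo.lean :: bakerKernel`. The **Baker kernel** of the genus-2 curve `y² = f(x) = 4x⁵ + λ₄x⁴ + λ₃x³ + λ₂x² + λ₁x + λ₀`:
`𝔎(z) = (ρ₁(z₁) + ρ₂(z₁)·z₀) / (√f(z₁) √f(z₀))` with `ρ₁(x) = (12x³ + 2λ₄x² + λ₃x)/4`, `ρ₂(x) = x²` — the numerators of
the second-kind differentials `drₖ = ρₖ dx/y` dual to `du₁ = dx/y`, `du₂ = x dx/y` (Baker 1907; Buchstaber–Enolskii–Leykin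
1997, §2), paired against `du₁, du₂` in the variable `z₀`: `𝔎 dz₁ dz₀ = Σₖ drₖ(z₁) duₖ(z₀)`.
[cite: KontsevichZagier2001, §1.2] -/
def bakerKernel (f : ℝ → ℝ) (l₄ l₃ : ℝ) (z : Fin 2 → ℝ) : ℝ :=
  ((12 * z 1 ^ 3 + 2 * l₄ * z 1 ^ 2 + l₃ * z 1) / 4 + z 1 ^ 2 * z 0) / (Real.sqrt (f (z 1)) * Real.sqrt (f (z 0)))

/-- Verbatim copy of `Lines/NeronTorsionGenusTwo.lean :: GenusTwoNeronSector`. **Member `true`: the TIED GENUS-TWO NÉRON SECTOR STATEMENT.**  Data: a real genus-2 `M`-curve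
`y² = f(x) = 4x⁵ + λ₄x⁴ + … + λ₀ = 4(x−e₁)(x−e₂)(x−e₃)(x−e₄)(x−e₅)`, `e₁ > e₂ > e₃ > e₄ > e₅`; a real PAIR of points
`P₁ = (x₁, ε√f(x₁))` on the infinite branch (`x₁ > e₁`, `ε = ±1`) and `P₂ = (x₂, +√f(x₂))` on the oval over `(e₃, e₂)`;
the TORSION TIE: the real Abel–Jacobi displacement of the divisor class `[P₁ + P₂ − E₁ − E₃]`, times `2M`, is the
integer combination `n₁·a₁ + n₂·a₂` of the two real periods (ovals `a₁ = (e₅,e₄)`, `a₂ = (e₃,e₂)`), for BOTH holomorphic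
differentials `dx/y`, `x dx/y` (so the class is torsion of order dividing `4M` on the Jacobian; no group law is used to
say so).  Representations pinned as: `rI₁`, `rI₂` = the iterated Baker triangles `e₁ < z₁ < z₀ < x₁`, `e₃ < z₁ < z₀ < x₂`
of `𝔎`; `rX` = the cross rectangle `z₁ ∈ (e₁,x₁), z₀ ∈ (e₃,x₂)` of `ε𝔎`; `rJ` = the third-kind exchange integral
`∫_{e₃}^{x₂} (ε√f(x₁) − √f(t)) dt / (2(x₁ − t)√f(t))`; `R_ab` = the four period rectangles `z₀ ∈ a_a, z₁ ∈ a_b` of `4𝔎`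
(values `(2∮_{a_a} du)ᵀ(2∮_{a_b} dr)`); `rB = [1<t<B, dt/t]`.  The VALUE HYPOTHESIS
`8M²(I₁ + I₂ + X − J) − Σ_{a,b} n_a n_b 𝕄_{ab} = c·log B` gives the element
`8M²•([rI₁]+[rI₂]+[rX]−[rJ]) − Σ n_a n_b•[R_ab] − c•[rB] ∈ KZ.relations`.
(Value level — Néron/Riemann: the left side is `8M²(λ_Θ(P₁+P₂) − λ_Θ(E₁+E₃)) + 4M² log((x₁−e₃)/(e₁−e₃))`, `λ_Θ = −log|σ| + ½Re(uᵀηω⁻¹u)`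
the Néron function of the theta divisor of `Jac`, whose values at torsion points are `(1/8)log|ψ₃|`-type logarithms of
algebraic numbers.) [cite: KontsevichZagier2001, §1.2] [cite: Lang1983, Ch. 11 Thm 1.1, Ch. 13] -/
def GenusTwoNeronSector : Prop :=
  ∀ (e₁ e₂ e₃ e₄ e₅ l₄ l₃ l₂ l₁ l₀ x₁ x₂ ε B : ℝ) (M : ℕ) (n₁ n₂ c : ℤ) (f : ℝ → ℝ),
    (∀ x, f x = 4 * x ^ 5 + l₄ * x ^ 4 + l₃ * x ^ 3 + l₂ * x ^ 2 + l₁ * x + l₀) →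
    (∀ x, f x = 4 * (x - e₁) * (x - e₂) * (x - e₃) * (x - e₄) * (x - e₅)) →
    e₅ < e₄ → e₄ < e₃ → e₃ < e₂ → e₂ < e₁ → e₁ < x₁ → (ε = 1 ∨ ε = -1) → e₃ < x₂ → x₂ < e₂ → 0 < M →
    2 * (M : ℝ) * (ε * (∫ x in Set.Ioo e₁ x₁, (Real.sqrt (f x))⁻¹) + ∫ x in Set.Ioo e₃ x₂, (Real.sqrt (f x))⁻¹) =
      n₁ * (2 * ∫ x in Set.Ioo e₅ e₄, (Real.sqrt (f x))⁻¹) + n₂ * (2 * ∫ x in Set.Ioo e₃ e₂, (Real.sqrt (f x))⁻¹) →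
    2 * (M : ℝ) * (ε * (∫ x in Set.Ioo e₁ x₁, x / Real.sqrt (f x)) + ∫ x in Set.Ioo e₃ x₂, x / Real.sqrt (f x)) =
      n₁ * (2 * ∫ x in Set.Ioo e₅ e₄, x / Real.sqrt (f x)) + n₂ * (2 * ∫ x in Set.Ioo e₃ e₂, x / Real.sqrt (f x)) →
    1 < B →
    ∀ (rI₁ rI₂ rX R₁₁ R₁₂ R₂₁ R₂₂ : KZ.IntegralRep 2) (rJ rB : KZ.IntegralRep 1),
    rI₁.domain = {z | e₁ < z 1 ∧ z 1 < z 0 ∧ z 0 < x₁} → Set.EqOn rI₁.integrand (bakerKernel f l₄ l₃) rI₁.domain →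
    rI₂.domain = {z | e₃ < z 1 ∧ z 1 < z 0 ∧ z 0 < x₂} → Set.EqOn rI₂.integrand (bakerKernel f l₄ l₃) rI₂.domain →
    rX.domain = {z | e₁ < z 1 ∧ z 1 < x₁ ∧ e₃ < z 0 ∧ z 0 < x₂} →
    Set.EqOn rX.integrand (fun z => ε * bakerKernel f l₄ l₃ z) rX.domain →
    rJ.domain = {t | e₃ < t 0 ∧ t 0 < x₂} →
    Set.EqOn rJ.integrand
      (fun t => (ε * Real.sqrt (f x₁) - Real.sqrt (f (t 0))) / (2 * (x₁ - t 0) * Real.sqrt (f (t 0)))) rJ.domain →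
    R₁₁.domain = {z | e₅ < z 0 ∧ z 0 < e₄ ∧ e₅ < z 1 ∧ z 1 < e₄} →
    Set.EqOn R₁₁.integrand (fun z => 4 * bakerKernel f l₄ l₃ z) R₁₁.domain →
    R₁₂.domain = {z | e₅ < z 0 ∧ z 0 < e₄ ∧ e₃ < z 1 ∧ z 1 < e₂} →
    Set.EqOn R₁₂.integrand (fun z => 4 * bakerKernel f l₄ l₃ z) R₁₂.domain →
    R₂₁.domain = {z | e₃ < z 0 ∧ z 0 < e₂ ∧ e₅ < z 1 ∧ z 1 < e₄} →
    Set.EqOn R₂₁.integrand (fun z => 4 * bakerKernel f l₄ l₃ z) R₂₁.domain →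
    R₂₂.domain = {z | e₃ < z 0 ∧ z 0 < e₂ ∧ e₃ < z 1 ∧ z 1 < e₂} →
    Set.EqOn R₂₂.integrand (fun z => 4 * bakerKernel f l₄ l₃ z) R₂₂.domain →
    rB.domain = {t | 1 < t 0 ∧ t 0 < B} → Set.EqOn rB.integrand (fun t => (t 0)⁻¹) rB.domain →
    8 * (M : ℝ) ^ 2 * (rI₁.value + rI₂.value + rX.value - rJ.value) -
        ((n₁ : ℝ) ^ 2 * R₁₁.value + n₁ * n₂ * R₁₂.value + n₂ * n₁ * R₂₁.value + (n₂ : ℝ) ^ 2 * R₂₂.value) =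
      c * rB.value →
    (8 * (M : ℤ) ^ 2) • (KZ.of rI₁ + KZ.of rI₂ + KZ.of rX - KZ.of rJ) -
        ((n₁ ^ 2) • KZ.of R₁₁ + (n₁ * n₂) • KZ.of R₁₂ + (n₂ * n₁) • KZ.of R₂₁ + (n₂ ^ 2) • KZ.of R₂₂) -
      c • KZ.of rB ∈ KZ.relations

/-- Verbatim copy of `Lines/NeronTorsionGenusTwo.lean :: NeronTorsionGenusTwoMember` / `NeronTorsionGenusTwo`. **The member family of the rung, indexed by `Bool`** (genus `1 + two.toNat`): member `false` is the FLOOR VERBATIM —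
the route decl `Theses.TorsionLogs.NeronTorsionPrimitiveChain` (genus 1: one real torsion POINT of one real cubic);
member `true` is `GenusTwoNeronSector` (genus 2: one real torsion PAIR of one real quintic `M`-curve). -/
def NeronTorsionGenusTwoMember : Bool → Prop
  | false => NeronTorsionPrimitiveChain
  | true => GenusTwoNeronSector

/-- **THE RUNG `NeronTorsionGenusTwo`: both members.** -/
def NeronTorsionGenusTwo : Prop := ∀ two : Bool, NeronTorsionGenusTwoMember two

/-- Member `false` is the floor decl on the nose. -/
theorem false_iff : NeronTorsionGenusTwoMember false ↔ NeronTorsionPrimitiveChain :=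
  Iff.rfl

/-- **F3 witness (named):** the floor (seed `stub_assembly`, route link `NeronTorsionPrimitiveChain_holds`) is the
member `false` of the family (genus one). -/
theorem rung_false : NeronTorsionGenusTwoMember false :=
  NeronTorsionPrimitiveChain_holds

/-- The F3 `example` shape of the brief: the rung's member at the floor parameter, by the seed. -/
example : NeronTorsionGenusTwoMember false := by
  simpa [NeronTorsionGenusTwoMember] using NeronTorsionPrimitiveChain_holds

/-- The rung is exactly `floor ∧ member true` (honest containment: the rung adds ONE statement to the floor). -/
theorem rung_iff : NeronTorsionGenusTwo ↔ NeronTorsionPrimitiveChain ∧ GenusTwoNeronSector := by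
  constructor
  · exact fun h => ⟨h false, h true⟩
  · rintro ⟨h₀, h₁⟩ (_ | _)
    · exact h₀
    · exact h₁

/-- Given the floor (a theorem), the rung is equivalent to its new member. -/
theorem rung_iff_true : NeronTorsionGenusTwo ↔ NeronTorsionGenusTwoMember true :=
  ⟨fun h => h true, fun h => rung_iff.mpr ⟨NeronTorsionPrimitiveChain_holds, h⟩⟩

/-- **Specialisation by name:** the rung gives the floor decl. -/
@[simp] theorem floor_of_rung (h : NeronTorsionGenusTwo) : NeronTorsionPrimitiveChain :=
  h false

/-- **Specialisation as a type:** the rung gives the floor theorem's statement verbatim (the type of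
`Cruxes.NeronTorsionSector.Translation.stub_assembly`). -/
@[simp] theorem floorStatement_of_rung (h : NeronTorsionGenusTwo) :
    ∀ (g₂ g₃ e₁ xP yP : ℝ) (N a p q : ℕ) (f : ℝ → ℝ), (∀ x, f x = 4 * x ^ 3 - g₂ * x - g₃) → g₂ ^ 3 - 27 * g₃ ^ 2 ≠ 0 → f e₁ = 0 → 0 < e₁ → (∀ x, e₁ < x → 0 < f x) → e₁ < xP → yP ^ 2 = f xP → 3 ≤ N → 0 < a → 2 * a < N → (∀ hns : (⟨0, 0, 0, -g₂ / 4, -g₃ / 4⟩ : WeierstrassCurve ℝ).toAffine.Nonsingular xP (yP / 2), addOrderOf (WeierstrassCurve.Affine.Point.some xP (yP / 2) hns) = N) → (N : ℝ) * (∫ x in Set.Ioi xP, (Real.sqrt (f x))⁻¹) = a * (2 * ∫ x in Set.Ioi e₁, (Real.sqrt (f x))⁻¹) → Nat.Coprime p q → (q : ℤ) * ((N : ℤ) - 2 * (a : ℤ)) = (p : ℤ) * (2 * (N : ℤ)) → ∀ (rI rP : Literature.NumberTheory.Transcendental.KZ.IntegralRep 2), rI.domain = {z | e₁ < z 1 ∧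 z 1 < z 0 ∧ z 0 < xP} → Set.EqOn rI.integrand (fun z => z 1 / (Real.sqrt (f (z 1)) * Real.sqrt (f (z 0)))) rI.domain → rP.domain = {z | e₁ < z 0 ∧ e₁ < z 1} → Set.EqOn rP.integrand (fun z => (Real.sqrt (f (z 0)))⁻¹ * ((g₂ * z 1 + 2 * g₃) / (2 * (z 1) ^ 2 * Real.sqrt (f (z 1))))) rP.domain → ∃ (c : ℤ) (B : ℝ) (rB : Literature.NumberTheory.Transcendental.KZ.IntegralRep 1), 1 < B ∧ IsAlgebraic ℚ B ∧ rB.domain = {t | 1 < t 0 ∧ t 0 < B} ∧ Set.EqOn rB.integrand (fun t => (t 0)⁻¹) rB.domain ∧ ((q : ℤ) ^ 2) • Literature.NumberTheory.Transcendental.KZ.of rI + ((p : ℤ) ^ 2) • Literature.NumberTheory.Transcendental.KZ.of rP - c • Literature.NumberTheory.Transcendental.KZ.of rB ∈ Literature.NumberTheory.Transcendental.KZ.relations :=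
  h false

end Summit.KontsevichZagierPeriods.KontsevichZagierPeriods.Cruxes.TorsionSectorComplete.NeronTorsionGenusTwo.Special

end
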